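import Summits.Ventures.PercRepro.RankLevelSetLevelSevenT16Dev1
import Summits.Ventures.PercRepro.RankLevelSetLevelSevenT16Dev2
import Summits.Ventures.PercRepro.RankLevelSetLevelSevenT16Dev3
import Summits.Ventures.PercRepro.RankLevelSetLevelSevenT16Dev4
import Summits.Ventures.PercRepro.S4MidKeySixteen
import Summits.Ventures.PercRepro.S4SevenWindow
import Summits.Ventures.PercRepro.RankLevelSetLevelSixRowsNineToFifteen

/-!
# PercRepro — THE 16 ROW OF LEVEL `7`: `c025_core_seven_sixteen (d ≥ 8) : RLS M 16 7` ON EVERY `e`-FREE CORE OF RANK `16`, AND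
**THEOREM C₇ AT RANK `16`** (p7 g24, S4 feeder; p8's assembly shape — NO window claim, p9 owns S4)

The core cells `(16, d)`: `8 ≤ d ≤ 74` by the coloop device with the lossy ladder (`c025_core_seven_sixteen_<d>`: `k` coloops reduce to the natural cell
`(16 − k, d)` of the row `16 − k` at the same corank, the rest retired — the generic device `c025_core_seven_of_cells_free` in RankLevelSetLevelSevenT16Dev1, RankLevelSetLevelSevenT16Dev2, RankLevelSetLevelSevenT16Dev3, RankLevelSetLevelSevenT16Dev4),
`d ≥ 75` by p1's middle key (`S4Mid.c025_core_seven_midkey_sixteen`, no coloop-freeness needed). Then the level-6 glue `rls_seven_at_of_core 16` on `c025_six_all`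
(level `6` at `p = 15`) gives level `7` at `p = 16`: **`c025_seven_at_sixteen : RLS M 16 7`** for every finite matroid.
Axioms: standard.
-/

open scoped Matroid

namespace PercRepro

namespace ThmN

variable {α : Type}

/-- **The core cell `(16, d)` at every corank `d ≥ 8`, every `e`-free core.** -/
theorem c025_core_seven_sixteen (M : Matroid α) [M.Finite] (d : ℕ) (hd8 : 8 ≤ d)
    (hR : M.eRank = (16 : ℕ∞)) (hn : M.E.ncard = 16 + d)
    (hfree : ∀ e ∈ M.E, ∃ A ⊆ M.E \ {e}, e ∉ M.closure A ∧ e ∉ M.closure ((M.E \ {e}) \ A)) :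
    RLS M 16 7 := by
  rcases Nat.lt_or_ge d 75 with hlt | hge
  · interval_cases d
    · exact c025_core_seven_sixteen_8 M hR hn hfree
    · exact c025_core_seven_sixteen_9 M hR hn hfree
    · exact c025_core_seven_sixteen_10 M hR hn hfree
    · exact c025_core_seven_sixteen_11 M hR hn hfree
    · exact c025_core_seven_sixteen_12 M hR hn hfree
    · exact c025_core_seven_sixteen_13 M hR hn hfree
    · exact c025_core_seven_sixteen_14 M hR hn hfree
    · exact c025_core_seven_sixteen_15 M hR hn hfree
    · exact c025_core_seven_sixteen_16 M hR hn hfree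
    · exact c025_core_seven_sixteen_17 M hR hn hfree
    · exact c025_core_seven_sixteen_18 M hR hn hfree
    · exact c025_core_seven_sixteen_19 M hR hn hfree
    · exact c025_core_seven_sixteen_20 M hR hn hfree
    · exact c025_core_seven_sixteen_21 M hR hn hfree
    · exact c025_core_seven_sixteen_22 M hR hn hfree
    · exact c025_core_seven_sixteen_23 M hR hn hfree
    · exact c025_core_seven_sixteen_24 M hR hn hfree
    · exact c025_core_seven_sixteen_25 M hR hn hfree
    · exact c025_core_seven_sixteen_26 M hR hn hfree
    · exact c025_core_seven_sixteen_27 M hR hn hfree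
    · exact c025_core_seven_sixteen_28 M hR hn hfree
    · exact c025_core_seven_sixteen_29 M hR hn hfree
    · exact c025_core_seven_sixteen_30 M hR hn hfree
    · exact c025_core_seven_sixteen_31 M hR hn hfree
    · exact c025_core_seven_sixteen_32 M hR hn hfree
    · exact c025_core_seven_sixteen_33 M hR hn hfree
    · exact c025_core_seven_sixteen_34 M hR hn hfree
    · exact c025_core_seven_sixteen_35 M hR hn hfree
    · exact c025_core_seven_sixteen_36 M hR hn hfree
    · exact c025_core_seven_sixteen_37 M hR hn hfree
    · exact c025_core_seven_sixteen_38 M hR hn hfree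
    · exact c025_core_seven_sixteen_39 M hR hn hfree
    · exact c025_core_seven_sixteen_40 M hR hn hfree
    · exact c025_core_seven_sixteen_41 M hR hn hfree
    · exact c025_core_seven_sixteen_42 M hR hn hfree
    · exact c025_core_seven_sixteen_43 M hR hn hfree
    · exact c025_core_seven_sixteen_44 M hR hn hfree
    · exact c025_core_seven_sixteen_45 M hR hn hfree
    · exact c025_core_seven_sixteen_46 M hR hn hfree
    · exact c025_core_seven_sixteen_47 M hR hn hfree
    · exact c025_core_seven_sixteen_48 M hR hn hfree
    · exact c025_core_seven_sixteen_49 M hR hn hfree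
    · exact c025_core_seven_sixteen_50 M hR hn hfree
    · exact c025_core_seven_sixteen_51 M hR hn hfree
    · exact c025_core_seven_sixteen_52 M hR hn hfree
    · exact c025_core_seven_sixteen_53 M hR hn hfree
    · exact c025_core_seven_sixteen_54 M hR hn hfree
    · exact c025_core_seven_sixteen_55 M hR hn hfree
    · exact c025_core_seven_sixteen_56 M hR hn hfree
    · exact c025_core_seven_sixteen_57 M hR hn hfree
    · exact c025_core_seven_sixteen_58 M hR hn hfree
    · exact c025_core_seven_sixteen_59 M hR hn hfree
    · exact c025_core_seven_sixteen_60 M hR hn hfree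
    · exact c025_core_seven_sixteen_61 M hR hn hfree
    · exact c025_core_seven_sixteen_62 M hR hn hfree
    · exact c025_core_seven_sixteen_63 M hR hn hfree
    · exact c025_core_seven_sixteen_64 M hR hn hfree
    · exact c025_core_seven_sixteen_65 M hR hn hfree
    · exact c025_core_seven_sixteen_66 M hR hn hfree
    · exact c025_core_seven_sixteen_67 M hR hn hfree
    · exact c025_core_seven_sixteen_68 M hR hn hfree
    · exact c025_core_seven_sixteen_69 M hR hn hfree
    · exact c025_core_seven_sixteen_70 M hR hn hfree
    · exact c025_core_seven_sixteen_71 M hR hn hfree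
    · exact c025_core_seven_sixteen_72 M hR hn hfree
    · exact c025_core_seven_sixteen_73 M hR hn hfree
    · exact c025_core_seven_sixteen_74 M hR hn hfree
  · exact S4Mid.c025_core_seven_midkey_sixteen M (by omega) hfree

/-- **THEOREM C₇ AT RANK `16`**: level `7` at `p = 16` for every finite matroid (on level `6` at `p = 15`, `c025_six_all`). -/
theorem c025_seven_at_sixteen (M : Matroid α) [M.Finite] : RLS M 16 7 :=
  rls_seven_at_of_core 16 (by norm_num) (fun M _ => c025_six_all M 15 (by norm_num))
    (fun M _ d hd hR hn hfree => c025_core_seven_sixteen M d hd hR hn hfree) M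

end ThmN

end PercRepro
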